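/-
Copyright (c) 2026 the pub-hodgecm-mathlib formalisation cell (harness21).  Prover seat hodgecm-mathlib-K2E1-p11 (g2), Track B ∕ K2-LIT, h413 =
`stmt-HodgeConjecture-24833`, line `K2_E1_TraceFormulaBeta`, 5Res campaign «ENDGAME BY FAMILIES» ∕ ROADCARD §3′ (M2 v2, amendment #2 (228)(i′)), ruling (244)(x1) FILE B1: the
`χ`-section pseudo-Eisenstein family of `U(1,1)_{L∕L⁺}` is STABLE under `K_∞`-central pure tensors AT THE `L²(X)`-OPERATOR LEVEL: `R(h)[θ_{f,φ}] = [θ_{g,φ}]` with the explicit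
`g ∈ C²_c((0,∞))` of ★ FILE A `K2E1ChiSectionSmoothingProfileU2` (dictionary `orbitalSmoothing ∘ quotFun = quotFun ∘ R(h)`, the Eisenstein-level interchange, and ★ (E0)).
-/
import Summits.HodgeConjecture.HodgeConjecture.Theorems.K2E1ChiSectionSmoothingProfileU2     -- ★ (x1) FILE A p860455 (this seat): `rightConv_comp_borelHeight_mul_section_cm`; brings ★ D0 (`comp_borelHeight_eq_flatSectionU`, `radialCoeff`), ★ D4′d, ★ P3b FILE 2
import Summits.HodgeConjecture.HodgeConjecture.Theorems.K2E1ChiEisensteinHeckeMatrixU2          -- ★ row 10 (K2E1-p10): `integral_mul_eisensteinSeriesU_flatSectionU_eq_cm_two` (any continuous bounded coefficient, any `h ∈ C_c`)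
import Summits.HodgeConjecture.HodgeConjecture.Theorems.K2E1PseudoEisensteinSmoothingU            -- ★ F2a p860012 (K2E1-p10): `orbitalSmoothing_congr_ae'`; brings ★ (E0) `integratedOperator_rightRegular_ae_eq_orbitalSmoothing`
import Literature.NumberTheory.Automorphic.UnitaryGroupKernelDictionary                          -- ★ `quotientSubgroup_quasiSplit` (`A_G = 1`)
import HarnessLib

/-!
# (x1) FILE B1 — `K2E1ChiSectionHeckeStableCMTwo`: `R(h)[θ_{f,φ}] = [θ_{g,φ}]` in `L²(X)` for the `χ`-section pseudo-Eisenstein family of `U(1,1)_{L∕L⁺}`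

Cell `pub/hodgecm-mathlib`, crux H413 = `stmt-HodgeConjecture-24833`, route `HCCMUnconditional`; dealer K2E1-plan (g7) rulings (244)(x1) and 13:1xZ «FILE A∕B plan =».  THEOREMS ONLY (no `def` ∕
`instance` ∕ `notation` ∕ named-fact hypothesis ∕ `sorry`); lane `--kind proof --supports stmt-HodgeConjecture-24833 --as helper` (count-neutral; closes no socket).  Conventions: LEFT
Eisenstein series `θ_{f,φ} = eisensteinSeriesU (fun x => f (H x) * φ x)`, `quotFun F [g] = F(g⁻¹)`, `R(η) = integratedOperator rightRegular` (★ F2a currency), `(R(h)Φ)(x) = ∫ h(y)Φ(x·y) dν_G`.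
THE MATHEMATICS ([MoeglinWaldspurger1995, II.1.1–II.1.5]; [BorelJacquet1979, §4.6]; [BernsteinLapid2019, §4 Claim 1]).  (§1, ANY adelic datum `𝒢`) the dictionary between the orbital smoothing
on `X = G(𝔸) ⧸ A_G G(F)` and right smoothing on `G(𝔸)`: for `Φ̃` left-`A_G G(F)`-invariant, **`S_η(quotFun Φ̃) = quotFun(R(η)Φ̃)`** pointwise (`y⁻¹•[g] = [y⁻¹g]`, `quotFun Φ̃ [x] = Φ̃(x⁻¹)`).
(§2, `N = 2`, CM) **`R(h)E(Φ) = E(R(h)Φ)` for `Φ = (f∘H)·φ`**, `f ∈ C_c((0,∞))`, `φ` continuous bounded, ANY `h ∈ C_c(G(𝔸))`: `Φ = flatSectionU φ₂ 2` with the bounded continuous coefficient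
`φ₂ = H^{−2}·(f∘H)·φ` (★ D0), so ★ row 10 `integral_mul_eisensteinSeriesU_flatSectionU_eq_cm_two` applies verbatim.  (§3) With ★ FILE A: `R(h)E((f∘H)·φ) = E((g∘H)·φ)` for `f ∈ C²_c((0,∞))`, `φ`
a continuous bounded `χ`-section on whose flat sections `h` acts by the scalar `s` (binder `hact`), `g` the explicit smoothing profile.  (§4) `E((f∘H)·φ)` is left-`A_G G(F)`-invariant (`A_G = 1`
★ `quotientSubgroup_quasiSplit`, ★ `eisensteinSeriesU_rational_mul`, `H` and `χ`-sections are left-`B(F)`-invariant ★).  (§5) `L²(X)`: if `x =ᵐ quotFun E((f∘H)·φ)` and `x′ =ᵐ quotFun E((g∘H)·φ)`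
then **`R(h) x = x′`** — ★ (E0) (`R(η)x =ᵐ S_η x`), ★ F2a `orbitalSmoothing_congr_ae'`, §1, §3.  This is the generator relation `R(h) x_{(f,φ)} = x_{(g,φ)}` that FILE B2 transports through
★ K2E4-p10's isometry `U` to `U R(h) = M_{s_h} U` (letters `hU`∕`hscalar`).
* §1 `rightConv_quotientSubgroup_mul`, **`orbitalSmoothing_quotFun`**.  * §2 `radialSection_eq_flatSectionU`, **`integral_mul_eisensteinSeriesU_radialSection_cm_two`**.
* §3 **`integral_mul_eisensteinSeriesU_radialSection_eq_profile_cm_two`**.  * §4 `radialSection_toAdelic_mul`, **`eisensteinSeriesU_radialSection_quotientSubgroup_mul`**.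
* §5 **`integratedOperator_eq_of_ae_eq_radialSection_cm_two`**.
HONEST LABEL.  Count-neutral helper; proves no printed statement; letter-free except the binder `hact` (= ★ P1's action clause) and the boundedness `hφM` of the section.  HC_CM is proved
only modulo the 7 printed citations (2 remaining named inputs: hLiu418 = `stmt-HodgeConjecture-24832`, h413 = `stmt-HodgeConjecture-24833`) until rung 0 closes.

## References
* [MoeglinWaldspurger1995] C. Mœglin, J.-L. Waldspurger, *Spectral decomposition and Eisenstein series* (1995), II.1.1–II.1.5, II.2.4.
* [BorelJacquet1979] A. Borel, H. Jacquet, *Automorphic forms and automorphic representations*, PSPM 33.1 (1979), §4.6.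
* [BernsteinLapid2019] J. Bernstein, E. Lapid, *On the meromorphic continuation of Eisenstein series*, J. AMS 37 (2024), §4 Claim 1.
-/

set_option autoImplicit false
-- the mandated namespace repeats `HodgeConjecture.HodgeConjecture`, as in every `Theorems/*.lean` of this sub-problem
set_option linter.dupNamespace false

noncomputable section

open MeasureTheory MeasureTheory.Measure Set Filter Topology Complex NumberField CompactlySupported
open scoped NNReal
open Literature.NumberTheory.Automorphic Literature.NumberTheory.Automorphic.UnitaryGroup AdelicGroupData ContRepresentation
open Literature.NumberTheory.GaloisRepresentations (HeckeCharacter)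
open Summit.HodgeConjecture.HodgeConjecture.Cruxes.H413.K2E1BorelEisensteinU
open Summit.HodgeConjecture.HodgeConjecture.Cruxes.H413.K2E1CharacterEisensteinU2Defs
open Summit.HodgeConjecture.HodgeConjecture.Cruxes.H413.K2E1SphericalHeckeEigenSectionU2 (continuous_borelHeight_coe borelHeight_coe_pos)
open Summit.HodgeConjecture.HodgeConjecture.Cruxes.H413.K2E1PseudoEisensteinRadialCMTwo (continuous_radialCoeff exists_bound_radialCoeff comp_borelHeight_borelU_mul)
open Summit.HodgeConjecture.HodgeConjecture.Cruxes.H413.K2E1ChiEisensteinHeckeMatrixU2 (integral_mul_eisensteinSeriesU_flatSectionU_eq_cm_two)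
open Summit.HodgeConjecture.HodgeConjecture.Cruxes.H413.K2E1ChiSectionSmoothingProfileU2 (rightConv_comp_borelHeight_mul_section_cm)
open Summit.HodgeConjecture.HodgeConjecture.Cruxes.H413.K2E1SmoothedFormRepresentative (integratedOperator_rightRegular_ae_eq_orbitalSmoothing)
open Summit.HodgeConjecture.HodgeConjecture.Cruxes.H413.K2E1PseudoEisensteinSmoothingU (orbitalSmoothing_congr_ae')

namespace Summit.HodgeConjecture.HodgeConjecture.Cruxes.H413.K2E1ChiSectionHeckeStableCMTwo

/-! ## §1 The dictionary `S_η (quotFun Φ̃) = quotFun (R(η)Φ̃)` (any adelic datum) -/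

section Dictionary

universe u

variable {K : Type} [Field K] [NumberField K] (𝒢 : AdelicGroupData.{u} K) [MeasurableSpace 𝒢.Adelic]

/-- Right smoothing preserves left invariance: `Φ̃(γx) = Φ̃(x)` for `γ ∈ A_G G(F)` ⟹ the same for `x ↦ ∫ η(y)Φ̃(xy) dν`. [folklore] -/
theorem rightConv_quotientSubgroup_mul (ν : Measure 𝒢.Adelic) (η : 𝒢.Adelic → ℂ) {Φ : 𝒢.Adelic → ℂ} (hΦ : ∀ γ ∈ 𝒢.quotientSubgroup, ∀ g : 𝒢.Adelic, Φ (γ * g) = Φ g) :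
    ∀ γ ∈ 𝒢.quotientSubgroup, ∀ g : 𝒢.Adelic, (fun x : 𝒢.Adelic => ∫ y, η y * Φ (x * y) ∂ν) (γ * g) = (fun x : 𝒢.Adelic => ∫ y, η y * Φ (x * y) ∂ν) g := by
  intro γ hγ g
  show ∫ y, η y * Φ (γ * g * y) ∂ν = ∫ y, η y * Φ (g * y) ∂ν
  simp only [mul_assoc, hΦ γ hγ]

/-- **THE DICTIONARY `S_η(quotFun Φ̃) = quotFun(R(η)Φ̃)`**: for `Φ̃` left-`A_G G(F)`-invariant, the orbital smoothing `S_η F(ξ) = ∫ η(y)F(y⁻¹•ξ) dν` of `F = quotFun Φ̃` (`[g] ↦ Φ̃(g⁻¹)`) is `quotFun` of the right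
smoothing `x ↦ ∫ η(y)Φ̃(xy) dν` (`y⁻¹•[g] = [y⁻¹g]`, `(y⁻¹g)⁻¹ = g⁻¹y`). [cite: BorelJacquet1979, §4.6] [cite: MoeglinWaldspurger1995, II.1.1] -/
theorem orbitalSmoothing_quotFun (ν : Measure 𝒢.Adelic) (η : 𝒢.Adelic → ℂ) {Φ : 𝒢.Adelic → ℂ} (hΦ : ∀ γ ∈ 𝒢.quotientSubgroup, ∀ g : 𝒢.Adelic, Φ (γ * g) = Φ g) :
    orbitalSmoothing ν η (𝒢.quotFun Φ) = 𝒢.quotFun (fun x : 𝒢.Adelic => ∫ y, η y * Φ (x * y) ∂ν) := by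
  funext ξ
  obtain ⟨g, rfl⟩ : ∃ g : 𝒢.Adelic, 𝒢.toAutomorphicQuotient g = ξ := Quotient.exists_rep ξ
  rw [AdelicGroupData.quotFun_toAutomorphicQuotient (rightConv_quotientSubgroup_mul 𝒢 ν η hΦ) g]
  unfold orbitalSmoothing
  refine integral_congr_ae (Eventually.of_forall fun y => ?_)
  show η y • 𝒢.quotFun Φ (y⁻¹ • 𝒢.toAutomorphicQuotient g) = η y * Φ (g⁻¹ * y)
  rw [AdelicGroupData.smul_toAutomorphicQuotient, AdelicGroupData.quotFun_toAutomorphicQuotient hΦ, mul_inv_rev, inv_inv, smul_eq_mul]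

end Dictionary

/-! ## §2 `R(h)E(Φ) = E(R(h)Φ)` for a radial×section test field `Φ = (f∘H)·φ` on `U(1,1)_{L∕L⁺}` -/

section Two

variable (L : Type) [Field L] [NumberField L] [IsCMField L]

omit [NumberField L] [IsCMField L] in
/-- `(f∘H)·φ = flatSectionU (H^{−2}·(f∘H)·φ) 2` (★ D0 `comp_borelHeight_eq_flatSectionU` times `φ`). [cite: MoeglinWaldspurger1995, II.1.2] -/
theorem radialSection_eq_flatSectionU {F E : Type} [Field F] [NumberField F] [Field E] [NumberField E] [Algebra F E] {c : E ≃ₐ[F] E} {N : ℕ} [NeZero N]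
    (f : ℝ → ℂ) (φ : (quasiSplit F E c N).Adelic → ℂ) :
    (fun x : (quasiSplit F E c N).Adelic => f (borelHeight x : ℝ) * φ x) =
      flatSectionU (fun x : (quasiSplit F E c N).Adelic => (((borelHeight x : ℝ) : ℂ) ^ (-((2 : ℝ) : ℂ)) * f (borelHeight x : ℝ)) * φ x) ((2 : ℝ) : ℂ) := by
  funext x
  rw [flatSectionU_apply]
  have hne : (((borelHeight x : ℝ)) : ℂ) ≠ 0 := ofReal_ne_zero.2 (borelHeight_coe_pos x).ne'
  have hH : (((borelHeight x : ℝ)) : ℂ) ^ (-((2 : ℝ) : ℂ)) * (((borelHeight x : ℝ)) : ℂ) ^ ((2 : ℝ) : ℂ) = 1 := by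
    rw [← cpow_add _ _ hne, neg_add_cancel, cpow_zero]
  calc f (borelHeight x : ℝ) * φ x = ((((borelHeight x : ℝ)) : ℂ) ^ (-((2 : ℝ) : ℂ)) * (((borelHeight x : ℝ)) : ℂ) ^ ((2 : ℝ) : ℂ)) * (f (borelHeight x : ℝ) * φ x) := by
        rw [hH, one_mul]
    _ = (((borelHeight x : ℝ)) : ℂ) ^ (-((2 : ℝ) : ℂ)) * f (borelHeight x : ℝ) * φ x * (((borelHeight x : ℝ)) : ℂ) ^ ((2 : ℝ) : ℂ) := by ring

variable [MeasurableSpace (quasiSplit (↥(maximalRealSubfield L)) L (IsCMField.complexConj L) 2).Adelic] [BorelSpace (quasiSplit (↥(maximalRealSubfield L)) L (IsCMField.complexConj L) 2).Adelic]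

/-- **`R(h)E(Φ) = E(R(h)Φ)` FOR `Φ = (f∘H)·φ`** on `U(1,1)_{L∕L⁺}`: `f ∈ C_c((0,∞))`, `φ` continuous with `‖φ‖ ≤ M`, ANY `h ∈ C_c(G(𝔸))`, `ν_G` Haar:
`∫ h(y)·E(Φ)(g·y) dν_G = E(x ↦ ∫ h(y)Φ(xy) dν_G)(g)` — ★ row 10 at `z = 2` on the bounded continuous coefficient `H^{−2}(f∘H)φ` (★ D0 `continuous_radialCoeff`, `exists_bound_radialCoeff`).
[cite: MoeglinWaldspurger1995, II.1.5] [cite: BernsteinLapid2019, §4 Claim 1] -/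
theorem integral_mul_eisensteinSeriesU_radialSection_cm_two (νG : Measure (quasiSplit (↥(maximalRealSubfield L)) L (IsCMField.complexConj L) 2).Adelic) [νG.IsHaarMeasure]
    {h : (quasiSplit (↥(maximalRealSubfield L)) L (IsCMField.complexConj L) 2).Adelic → ℂ} (hh : Continuous h) (hhs : HasCompactSupport h)
    {f : ℝ → ℂ} (hfc : Continuous f) (hfs : HasCompactSupport f) (hf0 : tsupport f ⊆ Ioi 0)
    {φ : (quasiSplit (↥(maximalRealSubfield L)) L (IsCMField.complexConj L) 2).Adelic → ℂ} (hφc : Continuous φ) {M : ℝ} (hφM : ∀ x, ‖φ x‖ ≤ M)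
    (g : (quasiSplit (↥(maximalRealSubfield L)) L (IsCMField.complexConj L) 2).Adelic) :
    ∫ y, h y * eisensteinSeriesU (fun x : (quasiSplit (↥(maximalRealSubfield L)) L (IsCMField.complexConj L) 2).Adelic => f (borelHeight x : ℝ) * φ x) (g * y) ∂νG =
      eisensteinSeriesU (fun x : (quasiSplit (↥(maximalRealSubfield L)) L (IsCMField.complexConj L) 2).Adelic =>
        ∫ y, h y * (f (borelHeight (x * y) : ℝ) * φ (x * y)) ∂νG) g := by
  obtain ⟨C, hC⟩ := exists_bound_radialCoeff (F := ↥(maximalRealSubfield L)) (E := L) (c := IsCMField.complexConj L) (N := 2) hfc hfs hf0 2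
  have hC0 : 0 ≤ C := (norm_nonneg _).trans (hC 1)
  have hM0 : 0 ≤ M := (norm_nonneg _).trans (hφM 1)
  set φ₂ : (quasiSplit (↥(maximalRealSubfield L)) L (IsCMField.complexConj L) 2).Adelic → ℂ :=
    fun x => (((borelHeight x : ℝ) : ℂ) ^ (-((2 : ℝ) : ℂ)) * f (borelHeight x : ℝ)) * φ x with hφ₂
  have hΦ := radialSection_eq_flatSectionU (F := ↥(maximalRealSubfield L)) (E := L) (c := IsCMField.complexConj L) (N := 2) f φ
  have hφ₂c : Continuous φ₂ := (continuous_radialCoeff hfc hf0 2).mul hφc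
  have hφ₂M : ∀ x, ‖φ₂ x‖ ≤ C * M := fun x => by
    rw [hφ₂, norm_mul]
    exact mul_le_mul (hC x) (hφM x) (norm_nonneg _) hC0
  have h2 : 1 < (((2 : ℝ) : ℂ)).re := by rw [ofReal_re]; norm_num
  rw [hΦ]
  rw [integral_mul_eisensteinSeriesU_flatSectionU_eq_cm_two L νG hh hhs hφ₂c hφ₂M h2 g]
  congr 1
  funext x
  rw [flatSectionU_apply, mul_assoc, ← cpow_add _ _ (ofReal_ne_zero.2 (borelHeight_coe_pos x).ne'), neg_add_cancel, cpow_zero, mul_one]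
  refine integral_congr_ae (Eventually.of_forall fun y => ?_)
  show h y * flatSectionU φ₂ ((2 : ℝ) : ℂ) (x * y) = h y * (f (borelHeight (x * y) : ℝ) * φ (x * y))
  rw [congrFun hΦ (x * y)]

/-! ## §3 `R(h)E((f∘H)·φ) = E((g∘H)·φ)` with the explicit profile `g` of ★ FILE A -/

/-- **`R(h)E((f∘H)·φ) = E((g∘H)·φ)`** on `U(1,1)_{L∕L⁺}`: `f ∈ C²_c((0,∞))`, `φ` a continuous bounded `χ`-section on whose flat sections `h ∈ C_c(G(𝔸))` acts by the scalar `s` (binder `hact`,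
★ P1), `k₀ ∈ K` with `φ(k₀) ≠ 0`, and `g(r) = ∫ f(r·H(y))·h(k₀⁻¹y)φ(y)∕φ(k₀) dν_G` (★ FILE A `rightConv_comp_borelHeight_mul_section_cm`). [cite: MoeglinWaldspurger1995, II.1.2–II.1.5] [cite: BernsteinLapid2019, §4 Claim 1] -/
theorem integral_mul_eisensteinSeriesU_radialSection_eq_profile_cm_two (νG : Measure (quasiSplit (↥(maximalRealSubfield L)) L (IsCMField.complexConj L) 2).Adelic)
    [νG.IsHaarMeasure] [SFinite νG]
    {h : (quasiSplit (↥(maximalRealSubfield L)) L (IsCMField.complexConj L) 2).Adelic → ℂ} (hh : Continuous h) (hhs : HasCompactSupport h)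
    {χ : HeckeCharacter L} {φ : (quasiSplit (↥(maximalRealSubfield L)) L (IsCMField.complexConj L) 2).Adelic → ℂ} (hφ : IsChiSection χ φ) (hφc : Continuous φ)
    {M : ℝ} (hφM : ∀ x, ‖φ x‖ ≤ M)
    {k₀ : (quasiSplit (↥(maximalRealSubfield L)) L (IsCMField.complexConj L) 2).Adelic}
    (hk₀ : adelicVal (↥(maximalRealSubfield L)) L (IsCMField.complexConj L) 2 ((StdForm.antidiagonal 2).over L) k₀ ∈ standardMaximalCompactGL 2 L) (hx₀ : φ k₀ ≠ 0)
    {s : ℂ → ℂ} (hact : ∀ (z : ℂ) (x : (quasiSplit (↥(maximalRealSubfield L)) L (IsCMField.complexConj L) 2).Adelic),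
      ∫ y, h y * flatSectionU φ z (x * y) ∂νG = s z * flatSectionU φ z x)
    {f : ℝ → ℂ} (hf : ContDiff ℝ 2 f) (hfs : HasCompactSupport f) (hf0 : tsupport f ⊆ Ioi 0)
    (g : (quasiSplit (↥(maximalRealSubfield L)) L (IsCMField.complexConj L) 2).Adelic) :
    ∫ y, h y * eisensteinSeriesU (fun x : (quasiSplit (↥(maximalRealSubfield L)) L (IsCMField.complexConj L) 2).Adelic => f (borelHeight x : ℝ) * φ x) (g * y) ∂νG =
      eisensteinSeriesU (fun x : (quasiSplit (↥(maximalRealSubfield L)) L (IsCMField.complexConj L) 2).Adelic =>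
        (fun r : ℝ => ∫ y, f (r * (borelHeight y : ℝ)) * (h (k₀⁻¹ * y) * (φ y / φ k₀)) ∂νG) (borelHeight x : ℝ) * φ x) g := by
  rw [integral_mul_eisensteinSeriesU_radialSection_cm_two L νG hh hhs hf.continuous hfs hf0 hφc hφM g]
  congr 1
  funext x
  exact rightConv_comp_borelHeight_mul_section_cm L νG hh hhs hφ hφc hk₀ hx₀ hact hf hfs hf0 x

/-! ## §4 Left invariance of `E((f∘H)·φ)` under `A_G G(F) = G(F)` -/

omit [MeasurableSpace (quasiSplit (↥(maximalRealSubfield L)) L (IsCMField.complexConj L) 2).Adelic] [BorelSpace (quasiSplit (↥(maximalRealSubfield L)) L (IsCMField.complexConj L) 2).Adelic] in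
/-- `(f∘H)·φ` is left-`B(F)`-invariant for a `χ`-section `φ` (★ D0 `comp_borelHeight_borelU_mul`, ★ `IsChiSection.toAdelic_mul`). [cite: MoeglinWaldspurger1995, II.1.5] -/
theorem radialSection_toAdelic_mul {χ : HeckeCharacter L} {φ : (quasiSplit (↥(maximalRealSubfield L)) L (IsCMField.complexConj L) 2).Adelic → ℂ} (hφ : IsChiSection χ φ) (f : ℝ → ℂ) :
    ∀ b ∈ borelU ((IsCMField.complexConj L : L ≃ₐ[↥(maximalRealSubfield L)] L) : L →+* L) ((StdForm.antidiagonal 2).over L),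
      ∀ x : (quasiSplit (↥(maximalRealSubfield L)) L (IsCMField.complexConj L) 2).Adelic,
        (fun x : (quasiSplit (↥(maximalRealSubfield L)) L (IsCMField.complexConj L) 2).Adelic => f (borelHeight x : ℝ) * φ x)
          ((quasiSplit (↥(maximalRealSubfield L)) L (IsCMField.complexConj L) 2).toAdelic b * x) =
        (fun x : (quasiSplit (↥(maximalRealSubfield L)) L (IsCMField.complexConj L) 2).Adelic => f (borelHeight x : ℝ) * φ x) x := by
  intro b hb x
  have h1 := comp_borelHeight_borelU_mul (F := ↥(maximalRealSubfield L)) (E := L) (c := IsCMField.complexConj L) (N := 2) f b hb x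
  simp only at h1 ⊢
  rw [h1, hφ.toAdelic_mul b hb x]

omit [MeasurableSpace (quasiSplit (↥(maximalRealSubfield L)) L (IsCMField.complexConj L) 2).Adelic] [BorelSpace (quasiSplit (↥(maximalRealSubfield L)) L (IsCMField.complexConj L) 2).Adelic] in
/-- **`E((f∘H)·φ)` IS LEFT-`A_G G(F)`-INVARIANT** (`A_G = 1` for the quasi-split unitary datum ★ `quotientSubgroup_quasiSplit`; ★ `eisensteinSeriesU_rational_mul`). [cite: MoeglinWaldspurger1995, II.1.5] -/
theorem eisensteinSeriesU_radialSection_quotientSubgroup_mul {χ : HeckeCharacter L} {φ : (quasiSplit (↥(maximalRealSubfield L)) L (IsCMField.complexConj L) 2).Adelic → ℂ}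
    (hφ : IsChiSection χ φ) (f : ℝ → ℂ) :
    ∀ γ ∈ (quasiSplit (↥(maximalRealSubfield L)) L (IsCMField.complexConj L) 2).quotientSubgroup, ∀ g : (quasiSplit (↥(maximalRealSubfield L)) L (IsCMField.complexConj L) 2).Adelic,
      eisensteinSeriesU (fun x : (quasiSplit (↥(maximalRealSubfield L)) L (IsCMField.complexConj L) 2).Adelic => f (borelHeight x : ℝ) * φ x) (γ * g) =
        eisensteinSeriesU (fun x : (quasiSplit (↥(maximalRealSubfield L)) L (IsCMField.complexConj L) 2).Adelic => f (borelHeight x : ℝ) * φ x) g := by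
  intro γ hγ g
  rw [quotientSubgroup_quasiSplit] at hγ
  obtain ⟨γ', hγ'⟩ := MonoidHom.mem_range.1 hγ
  rw [← hγ']
  exact eisensteinSeriesU_rational_mul (radialSection_toAdelic_mul L hφ f) γ' g

/-! ## §5 The `L²(X)`-operator statement `R(h)[θ_{f,φ}] = [θ_{g,φ}]` -/

/-- **`R(h) x = x′` IN `L²(X)`** on `U(1,1)_{L∕L⁺}`: if `x =ᵐ quotFun E((f∘H)·φ)` and `x′ =ᵐ quotFun E((g∘H)·φ)` (`g` the profile of ★ FILE A for the data `(h, φ, k₀, s, f)` of §3), then the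
integrated operator `R(h) = ∫ h(y)R(y) dν_G` of the regular representation sends `x` to `x′` — ★ (E0) `R(h)x =ᵐ S_h x`, ★ F2a `orbitalSmoothing_congr_ae'`, §1 and §3∕§4.  This is the generator
relation `R(h)x_{(f,φ)} = x_{(g,φ)}` behind `U R(h) = M_{s_h} U` (FILE B2). [cite: BorelJacquet1979, §4.6] [cite: MoeglinWaldspurger1995, II.1.1–II.1.5, II.2.4] -/
theorem integratedOperator_eq_of_ae_eq_radialSection_cm_two
    [LocallyCompactSpace (quasiSplit (↥(maximalRealSubfield L)) L (IsCMField.complexConj L) 2).Adelic]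
    [SecondCountableTopology (quasiSplit (↥(maximalRealSubfield L)) L (IsCMField.complexConj L) 2).Adelic]
    (μ : Measure (quasiSplit (↥(maximalRealSubfield L)) L (IsCMField.complexConj L) 2).automorphicQuotient)
    [(quasiSplit (↥(maximalRealSubfield L)) L (IsCMField.complexConj L) 2).IsAutomorphicMeasure μ]
    (νG : Measure (quasiSplit (↥(maximalRealSubfield L)) L (IsCMField.complexConj L) 2).Adelic) [νG.IsHaarMeasure] [SFinite νG]
    (η : C_c((quasiSplit (↥(maximalRealSubfield L)) L (IsCMField.complexConj L) 2).Adelic, ℂ))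
    {χ : HeckeCharacter L} {φ : (quasiSplit (↥(maximalRealSubfield L)) L (IsCMField.complexConj L) 2).Adelic → ℂ} (hφ : IsChiSection χ φ) (hφc : Continuous φ)
    {M : ℝ} (hφM : ∀ x, ‖φ x‖ ≤ M)
    {k₀ : (quasiSplit (↥(maximalRealSubfield L)) L (IsCMField.complexConj L) 2).Adelic}
    (hk₀ : adelicVal (↥(maximalRealSubfield L)) L (IsCMField.complexConj L) 2 ((StdForm.antidiagonal 2).over L) k₀ ∈ standardMaximalCompactGL 2 L) (hx₀ : φ k₀ ≠ 0)
    {s : ℂ → ℂ} (hact : ∀ (z : ℂ) (x : (quasiSplit (↥(maximalRealSubfield L)) L (IsCMField.complexConj L) 2).Adelic),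
      ∫ y, η y * flatSectionU φ z (x * y) ∂νG = s z * flatSectionU φ z x)
    {f : ℝ → ℂ} (hf : ContDiff ℝ 2 f) (hfs : HasCompactSupport f) (hf0 : tsupport f ⊆ Ioi 0)
    (x x' : Lp ℂ 2 μ)
    (hx : (x : (quasiSplit (↥(maximalRealSubfield L)) L (IsCMField.complexConj L) 2).automorphicQuotient → ℂ) =ᵐ[μ]
      (quasiSplit (↥(maximalRealSubfield L)) L (IsCMField.complexConj L) 2).quotFun
        (eisensteinSeriesU (fun y : (quasiSplit (↥(maximalRealSubfield L)) L (IsCMField.complexConj L) 2).Adelic => f (borelHeight y : ℝ) * φ y)))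
    (hx' : (x' : (quasiSplit (↥(maximalRealSubfield L)) L (IsCMField.complexConj L) 2).automorphicQuotient → ℂ) =ᵐ[μ]
      (quasiSplit (↥(maximalRealSubfield L)) L (IsCMField.complexConj L) 2).quotFun
        (eisensteinSeriesU (fun y : (quasiSplit (↥(maximalRealSubfield L)) L (IsCMField.complexConj L) 2).Adelic =>
          (fun r : ℝ => ∫ w, f (r * (borelHeight w : ℝ)) * (η (k₀⁻¹ * w) * (φ w / φ k₀)) ∂νG) (borelHeight y : ℝ) * φ y))) :
    ((quasiSplit (↥(maximalRealSubfield L)) L (IsCMField.complexConj L) 2).rightRegular μ).integratedOperator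
        ((quasiSplit (↥(maximalRealSubfield L)) L (IsCMField.complexConj L) 2).isUnitary_rightRegular μ)
        ((quasiSplit (↥(maximalRealSubfield L)) L (IsCMField.complexConj L) 2).isStronglyContinuous_rightRegular_holds μ) νG η x = x' := by
  -- `R(η)x =ᵐ S_η x =ᵐ S_η (quotFun θ_{f,φ}) = quotFun (R(η)θ_{f,φ}) = quotFun θ_{g,φ} =ᵐ x′`
  refine Lp.ext_iff.2 ?_
  have h1 := integratedOperator_rightRegular_ae_eq_orbitalSmoothing (quasiSplit (↥(maximalRealSubfield L)) L (IsCMField.complexConj L) 2) μ νG η x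
  have h2 := orbitalSmoothing_congr_ae' (quasiSplit (↥(maximalRealSubfield L)) L (IsCMField.complexConj L) 2) μ νG hx (η : (quasiSplit (↥(maximalRealSubfield L)) L (IsCMField.complexConj L) 2).Adelic → ℂ)
  have hinv := eisensteinSeriesU_radialSection_quotientSubgroup_mul L hφ f
  have h3 := orbitalSmoothing_quotFun (quasiSplit (↥(maximalRealSubfield L)) L (IsCMField.complexConj L) 2) νG (η : (quasiSplit (↥(maximalRealSubfield L)) L (IsCMField.complexConj L) 2).Adelic → ℂ) hinv
  have h4 : (fun x₁ : (quasiSplit (↥(maximalRealSubfield L)) L (IsCMField.complexConj L) 2).Adelic =>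
      ∫ y, η y * eisensteinSeriesU (fun y : (quasiSplit (↥(maximalRealSubfield L)) L (IsCMField.complexConj L) 2).Adelic => f (borelHeight y : ℝ) * φ y) (x₁ * y) ∂νG) =
      eisensteinSeriesU (fun y : (quasiSplit (↥(maximalRealSubfield L)) L (IsCMField.complexConj L) 2).Adelic =>
        (fun r : ℝ => ∫ w, f (r * (borelHeight w : ℝ)) * (η (k₀⁻¹ * w) * (φ w / φ k₀)) ∂νG) (borelHeight y : ℝ) * φ y) :=
    funext fun x₁ => integral_mul_eisensteinSeriesU_radialSection_eq_profile_cm_two L νG η.continuous η.hasCompactSupport hφ hφc hφM hk₀ hx₀ hact hf hfs hf0 x₁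
  rw [h4] at h3
  have h3' : orbitalSmoothing νG (η : (quasiSplit (↥(maximalRealSubfield L)) L (IsCMField.complexConj L) 2).Adelic → ℂ) ((quasiSplit (↥(maximalRealSubfield L)) L (IsCMField.complexConj L) 2).quotFun
      (eisensteinSeriesU (fun y : (quasiSplit (↥(maximalRealSubfield L)) L (IsCMField.complexConj L) 2).Adelic => f (borelHeight y : ℝ) * φ y))) =ᵐ[μ]
      (quasiSplit (↥(maximalRealSubfield L)) L (IsCMField.complexConj L) 2).quotFun (eisensteinSeriesU (fun y : (quasiSplit (↥(maximalRealSubfield L)) L (IsCMField.complexConj L) 2).Adelic =>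
        (fun r : ℝ => ∫ w, f (r * (borelHeight w : ℝ)) * (η (k₀⁻¹ * w) * (φ w / φ k₀)) ∂νG) (borelHeight y : ℝ) * φ y)) :=
    Eventually.of_forall fun ξ => congrFun h3 ξ
  exact (h1.trans h2).trans (h3'.trans hx'.symm)

end Two

end Summit.HodgeConjecture.HodgeConjecture.Cruxes.H413.K2E1ChiSectionHeckeStableCMTwo

end
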